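import Summits.KontsevichZagierPeriods.KontsevichZagierPeriods.Theorems.LinRedNormalFormHoffmanIndependenceSplit

/-!
# Crux `HoffmanIndependence` (stmt-KontsevichZagierPeriods-15045), line `weight_split` —
# stub `truncation_iff_sum_zagierDim_le_finrank`: the weight-`≤ N` truncation is a dimension count

The truncation of the crux at weight `≤ N` — `ℚ`-linear independence of the real Hoffman values
`ζ(u)`, `u ∈ {2,3}^×`, `|u| ≤ N` — is a family of `d_{≤N} := ∑_{k ≤ N} d_k` vectors
(`d_k = zagierDim k = #{u ∈ {2,3}^× : |u| = k}`, `zagierDim_eq_card_hoffman_holds`) whose `ℚ`-span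
is exactly the filtered span `⨆_{k ≤ N} hoffmanSpan k`; hence
(`linearIndependent_iff_card_le_finrank_span`) it is independent iff
`d_{≤N} ≤ dim_ℚ ⨆_{k ≤ N} hoffmanSpan k` — the exact analogue, for initial segments of weights, of
the one-weight statement `inWeight_iff_zagierDim_le_finrank` of the Split file.

Main result: `truncation_iff_sum_zagierDim_le_finrank` (sorry-free, standard axioms). Helpers
(all theorems, no new definitions): `nonempty_truncationEquivSigma` (the `Σ`-reindexing of the
Hoffman indices of weight `≤ N` by their weight in `Fin (N + 1)`), `finite_hoffman_le`,
`card_hoffman_le`, `span_range_hoffman_le`. This file supports the item, it does not close it.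
[cite: Zagier1994, §9] [cite: Hoffman1997]
-/

noncomputable section

namespace Summit.KontsevichZagierPeriods.LinRedNormalForm.HoffmanIndependence

open Literature.NumberTheory.Transcendental MZV

/-- The `Σ`-reindexing by weight: a Hoffman index of weight `≤ N` is the same as a weight
`k < N + 1` together with a Hoffman index of weight exactly `k`
(`u ↦ ⟨|u|, u⟩`, `⟨k, w⟩ ↦ w`). [folklore] -/
theorem nonempty_truncationEquivSigma (N : ℕ) :
    Nonempty ({u : List ℕ // IsHoffman u ∧ weight u ≤ N} ≃
      Σ k : Fin (N + 1), {w : List ℕ // IsHoffman w ∧ weight w = (k : ℕ)}) :=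
  ⟨{ toFun := fun u => ⟨⟨weight u.1, Nat.lt_succ_of_le u.2.2⟩, ⟨u.1, u.2.1, rfl⟩⟩
     invFun := fun i => ⟨i.2.1, i.2.2.1, by
       have h1 := i.2.2.2
       have h2 := i.1.isLt
       omega⟩
     left_inv := fun _ => rfl
     right_inv := by
       rintro ⟨⟨k, hk⟩, ⟨w, hw, hwk⟩⟩
       change weight w = k at hwk
       subst hwk
       rfl }⟩

/-- The Hoffman indices of weight `≤ N` form a finite type (finitely many weights, and finitely
many Hoffman indices of each weight, `finite_hoffman`). [folklore] -/
theorem finite_hoffman_le (N : ℕ) : Finite {u : List ℕ // IsHoffman u ∧ weight u ≤ N} := by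
  obtain ⟨e⟩ := nonempty_truncationEquivSigma N
  haveI : ∀ k : Fin (N + 1), Finite {w : List ℕ // IsHoffman w ∧ weight w = (k : ℕ)} :=
    fun k => finite_hoffman k
  exact Finite.of_equiv _ e.symm

/-- There are exactly `d_{≤N} = ∑_{k ≤ N} d_k` Hoffman indices of weight `≤ N`
(`d_k = #{u ∈ {2,3}^× : |u| = k}`, `zagierDim_eq_card_hoffman_holds`). [cite: Hoffman1997] -/
theorem card_hoffman_le (N : ℕ) :
    Nat.card {u : List ℕ // IsHoffman u ∧ weight u ≤ N} =
      ∑ k ∈ Finset.range (N + 1), zagierDim k := by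
  obtain ⟨e⟩ := nonempty_truncationEquivSigma N
  haveI : ∀ k, Finite {w : List ℕ // IsHoffman w ∧ weight w = k} := fun k => finite_hoffman k
  rw [Nat.card_congr e, Nat.card_sigma, Finset.sum_range]
  exact Finset.sum_congr rfl fun k _ => (zagierDim_eq_card_hoffman_holds k).symm

/-- The `ℚ`-span of the real Hoffman values of weight `≤ N` (as the range of `u ↦ ζ(u)` over the
Hoffman indices of weight `≤ N`) is the filtered span `⨆_{k ≤ N} hoffmanSpan k`. [folklore] -/
theorem span_range_hoffman_le (N : ℕ) :
    Submodule.span ℚ (Set.range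
      fun u : {u : List ℕ // IsHoffman u ∧ weight u ≤ N} => multipleZeta u.1) =
      ⨆ k ∈ Finset.range (N + 1), hoffmanSpan k := by
  apply le_antisymm
  · refine Submodule.span_le.2 (Set.range_subset_iff.2 fun u => ?_)
    have h1 : multipleZeta u.1 ∈ hoffmanSpan (weight u.1) :=
      Submodule.subset_span ⟨u.1, u.2.1, rfl, rfl⟩
    exact (le_biSup hoffmanSpan (Finset.mem_range.2 (Nat.lt_succ_of_le u.2.2))) h1
  · refine iSup₂_le fun k hk => ?_
    have hk' : k ≤ N := Nat.le_of_lt_succ (Finset.mem_range.1 hk)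
    unfold hoffmanSpan
    refine Submodule.span_mono ?_
    rintro x ⟨s, hs, hw, rfl⟩
    exact ⟨⟨s, hs, hw.symm ▸ hk'⟩, rfl⟩

/-- **The weight-`≤ N` truncation of the crux is a dimension count**: the real Hoffman values
`ζ(u)`, `u ∈ {2,3}^×`, `|u| ≤ N`, are `ℚ`-linearly independent iff
`d_{≤N} = ∑_{k ≤ N} d_k ≤ dim_ℚ ⨆_{k ≤ N} hoffmanSpan k` (there are exactly `d_{≤N}` of them,
`card_hoffman_le`; they span exactly the filtered span, `span_range_hoffman_le`; and finitely many
vectors are independent iff their number is at most the dimension of their span,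
`linearIndependent_iff_card_le_finrank_span`). The analogue for initial segments of weights of
`inWeight_iff_zagierDim_le_finrank`; the reverse inequality always holds (`finrank_range_le_card`).
[cite: Zagier1994, §9] -/
theorem truncation_iff_sum_zagierDim_le_finrank : ∀ N : ℕ, LinearIndependent ℚ (fun u : {u : List ℕ // IsHoffman u ∧ weight u ≤ N} => multipleZeta u.1) ↔ (∑ k ∈ Finset.range (N + 1), zagierDim k) ≤ Module.finrank ℚ ↥(⨆ k ∈ Finset.range (N + 1), hoffmanSpan k) := by
  intro N
  haveI := finite_hoffman_le N
  letI := Fintype.ofFinite {u : List ℕ // IsHoffman u ∧ weight u ≤ N}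
  rw [linearIndependent_iff_card_le_finrank_span]
  unfold Set.finrank
  rw [span_range_hoffman_le, ← Nat.card_eq_fintype_card, card_hoffman_le]

end Summit.KontsevichZagierPeriods.LinRedNormalForm.HoffmanIndependence
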